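import Summits.ABC.IUTFork.Cor312LicenceOfMultiReach
import Summits.ABC.IUTFork.Thm311RealIsmDHOrbitSpan
import Summits.ABC.IUTFork.Cor312PilotIdelesPrCapstone
import HarnessLib

/-!
# [IUTchIII] Cor. 3.12 — the (xi-f) LICENCE at the sharp genuine settings from a GRADED (per-slot) reach:
# «uniform unit-slot gain `r` over the fibre» + «graded cell `‖t_q‖ ≤ (pilot reach)·r^j`» ⟹ multi-reach ⟹ licence cell,
# with the gains read off the LOG-UNIT LATTICE by (Ind2)-transitivity — the R-W WILD TEMPLATE (any place type, several places over `p`)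

PROOF-ONLY file (D-0012: 0 definitions, 0 `Prop` facts, no instance, no notation; abc-iut cell, rung LADDER-ABC:A2.RP → A2.RESCUE-H /
A2.RESCUE-W; seat abc-iut-rp-h3 gen 5, GO BY NAME of abc-iut-rh-lead 2026-08-26T16:32:56Z «row 14's genuine-bed k2 file (multi-reach
instantiation `Real.licence_settingPrVolSharp_of_multiReach` → H⋆-cell ⇒ licence cell at settingPrVolSharp) — the R-W WILD TEMPLATE vehicle
(abc-iut-rp-d3's deferred item rides on it)»; item (α) of this lineage, genuine WILD / multi-place half). TAKES NO SIDE on [IUTchIII] Cor. 3.12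
or on any author: every statement is about OUR typed objects — abc-iut-c312-7's sharp settings `Real.settingDHVolSharp` /
`Real.settingPrVolSharp` (ANY `PilotData X`, all context binders free, ANY fibre over `p`: several places, wild ramification and `p = 2`
allowed), Dupuy–Hilado's typed (Ind2) `Real.ismDH` = ALL shell-preserving bicontinuous lattice automorphisms (§4.9), the sharp idele boxes.
Row 14 (`graded-shell-orbit`, abc-iut-lens-control-3) is a HYPOTHESIS of the R-H table; typed ≠ proved; instantiated ≠ endorsed.
INPUTS BY NAME (nothing re-typed): abc-iut-w5-d107 `qRegion_subset_thetaHull_settingDHVolSharp_of_multiReach` /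
`licence_settingDHVolSharp_of_multiReach` (p-ids in `Cor312LicenceOfMultiReach`), abc-iut-w5-d180 `exists_mem_ismDH_apply_eq_of_primitive`
(`Thm311RealIsmDHOrbitSpan`), abc-iut-c312-7 `bridgeHyps_settingPrVolSharp_of_ideles`, abc-iut-c312-1 `Thm311ToCor312.statement_of_licence`.

WHY. abc-iut-w5-d107's MULTI-REACH is stated per SUMMAND `v⃗` of the packet `(j, p)` (one place per tensor slot) with movers and integers
chosen per slot: the quantifier shape a table cannot evaluate. The R-H / R-W tables want ONE number per (datum, place, label). This file
re-cuts multi-reach into that shape — a GRADED reach — and reads the numbers off the log-unit lattice: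
* §1 `multiReach_of_gradedReach` — at the packet `(i+1, p)`: a UNIFORM UNIT-SLOT GAIN `r ≥ 0` over the fibre (at every `x | p` some
  (Ind2)-mover carries some integer `y`, `‖y‖ ≤ 1`, to norm `≥ r`) and, at every pilot place `x`, the GRADED CELL «some mover carries
  `t_{Θ,i+1,x}·y` to norm `R_x` with `‖t_{q,x}‖ ≤ R_x · r^{i+1}`» (`i+1 = j` unit slots) ⟹ MULTI-REACH for every summand; `multiReach_of_gradedCell`
  (pilot slot unmoved: `‖t_{q,x}‖ ≤ ‖t_{Θ,i+1,x}‖ · r^{i+1}` — the CARD's «h(w,j) ≤ j·κ(w)» shape).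
* §2 `qRegion_subset_thetaHull_settingDHVolSharp_of_gradedReach` (⟹ licence cell at `(i+1, p)`), `…settingPrVolSharp…`,
  `licence_settingDHVolSharp_of_gradedReach` / `licence_settingPrVolSharp_of_gradedReach` (every packet ⟹ the typed (xi-f) Licence),
  `statement_settingPrVolSharp_of_gradedReach` (⟹ the typed Statement of Cor. 3.12 at the genuine sharp setting, ideles units off `S`).
* §3 THE GAINS FROM THE LOG-UNIT LATTICE (no tameness, no uniqueness of the place): `exists_mem_ism_apply_eq_of_sameLevel` — two vectors at
  the SAME PRIMITIVE LEVEL `c·log_p(𝒪^×_x) ∖ p·c·log_p(𝒪^×_x)` are related by a typed (Ind2)-mover (w5-d180's transitivity transported to the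
  presentation `φ_x`, `kOf`); hence `unitGain_of_levelOne` (an element `z` at the level of `1` ⟹ unit-slot gain `‖z‖`) and
  `pilotReach_of_level` (an element `z` at the level of `t_{Θ,i+1,x}` ⟹ pilot reach `‖z‖`).
* §4 THE WILD CELL, assembled: **`qRegion_subset_thetaHull_settingDHVolSharp_of_latticeLevels`** — per place `x | p` an element `z₁(x)` at the
  level of `1` with `r ≤ ‖z₁(x)‖` (`r` uniform over the fibre) and an element `z_Θ(x)` at the level of `t_{Θ,i+1,x}` with
  `‖t_{q,x}‖ ≤ ‖z_Θ(x)‖ · r^{i+1}` ⟹ licence cell at `(i+1, p)`; `licence_settingPrVolSharp_of_latticeLevels`, `statement_settingPrVolSharp_of_latticeLevels`.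
COLUMN READING (neutral; for rows 3/4/14 of plan/rescue/R-H/RH-CANDIDATES and W's wild packets): in `K_x`-normalised exponents the licence cell
at `(j, p)` is implied by `ord(t_{q,x}) ≥ ord(z_Θ(x)) + j · max_{x' | p} ord(z₁(x'))`, where `ord(z₁(x'))` is the OUTER exponent of the
lattice level of `1` in `log_p(𝒪^×_{x'})` (`= 1 − e` at a tame place: abc-iut-w4-d087 / this lineage's p450461) and `ord(z_Θ(x))` the outer
exponent of the level of the Θ-idele: the CARD's «h ≤ j·κ» with `κ` the EXACT outer radius of the level (U-SHAPE's `r_out`), binding at the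
WORST place over `p` — a SUFFICIENT cell; the exact cell is abc-iut-c312-5's T2 iff (`iota_smul_subset_packetHull_orbit_iota_smul_iff`).
HONEST SCOPE (binding): OUR sharp containers (Θ-regions constant in the column index), DH's (Ind2) as lattice automorphisms per (slot, place);
the packet-level licence is a STRONGER-THAN-PRINT reading of Step (xi-f); nothing about the printed global inequality or initial Θ-data of
[IUTchI] Def. 3.1; nothing asserts or refutes [IUTchIII] Cor. 3.12. [cite: DupuyHilado2025, §3.9, §4.7, §4.9] [cite: WeilBNT1967, Ch. II §2,
Th. 1] [cite: ScholzeStix2018, §2.2 pp. 9–10] [cite: Mochizuki2012, IUTchIII Cor. 3.12 p. 173–174, Step (xi-f) p. 184]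
[claim: Mochizuki2012, status: disputed] for every IUT locution. Axioms: standard.
-/

noncomputable section

open Set Function NumberField IsDedekindDomain
open scoped Pointwise

namespace Summit.ABC.IUTFork.Thm311.Real

open Cor312 Cor312Vol Literature.IUT.LogThetaLattice Literature.IUT.LogVolume
  Literature.NumberTheory.NumberFields Literature.NumberTheory.GaloisRepresentations.Ultrametric

variable {F : Type} [Field F] [NumberField F] (X : PilotData F) {logv : PadicLogs F} (hlog : LogvAnalytic logv)
  (M : Type) [Field M] [NumberField M]
  (archPk : ∀ (j : (thetaIndex X).Label) (vQ : (thetaIndex X).VQ), Set ((logShellsDH X logv).Packet j vQ))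
  (archSub : ∀ (j : (thetaIndex X).Label) (v : (thetaIndex X).V),
    Set ((logShellsDH X logv).Packet j ((thetaIndex X).over v)))
  (Ψ : ℤ → ∀ v : (thetaIndex X).V, v ∈ (thetaIndex X).Vbad → Set ((logShellsDH X logv).StarPacket v))
  (act : ℤ → ∀ v : (thetaIndex X).V, v ∈ (thetaIndex X).Vbad →
    (logShellsDH X logv).StarPacket v → Module.End ℚ ((logShellsDH X logv).StarPacket v))
  (Mmod : ℤ → ∀ j : (thetaIndex X).LabelStar, Set ((logShellsDH X logv).GlobalPacket j.1))
  (region : ℤ → ∀ j : (thetaIndex X).LabelStar, FinDivisor M → ∀ vQ : (thetaIndex X).VQ,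
    Set ((logShellsDH X logv).Packet j.1 vQ))
  (n : ℤ) {HT : Type} {LogLink : HT → HT → Type} {IsFull : ∀ {s t : HT}, LogLink s t → Prop}
  (lat : LGPGaussianLogThetaLattice LogLink IsFull)
  {Frd : Type} {IsoF : Frd → Frd → Type} {Ob : Frd → Type} {realify : Frd → Frd} {Strip : Type}
  {IsoS : Strip → Strip → Type} {Mv : ∀ v : (thetaIndex X).V, v ∈ (thetaIndex X).Vbad → Type}
  [∀ v h, Monoid (Mv v h)]
  (sig : GlobalLGPFrobenioidSignature (thetaIndex X).lstar (thetaIndex X).V (· ∈ (thetaIndex X).Vbad)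
    Frd IsoF Ob realify Strip IsoS Mv)
  (split : SplittingMonoids Mv) {ObΔ : Type} {N : ∀ v : (thetaIndex X).V, v ∈ (thetaIndex X).Vbad → Type}
  [∀ v h, Monoid (N v h)] (qData : QPilotData ObΔ N)
  (tq : ∀ (pp : Nat.Primes) (x : (thetaIndex X).Fibre (.inr pp)), haveI : Fact (pp : ℕ).Prime := ⟨pp.2⟩; kOf X pp.1 x)
  (t : ∀ (pp : Nat.Primes) (_ : Fin X.lstar) (x : (thetaIndex X).Fibre (.inr pp)),
    haveI : Fact (pp : ℕ).Prime := ⟨pp.2⟩; kOf X pp.1 x)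
  (htq0 : ∀ pp x, tq pp x ≠ 0)
  (htq1 : ∀ (pp : Nat.Primes) (x : (thetaIndex X).Fibre (.inr pp)),
    haveI : Fact (pp : ℕ).Prime := ⟨pp.2⟩; placeOf X pp.1 x ∉ X.S → ‖tq pp x‖ = 1)

/-! ## 1. An (Ind2)-family acting on ALL tensor slots, and its effect on pure tensors -/

/-! ## §1. Graded reach ⟹ multi-reach (pure bookkeeping over abc-iut-w5-d107's hypothesis shape) -/

section Graded

variable (pp : Nat.Primes) [Fact (pp : ℕ).Prime]

/-- **GRADED REACH ⟹ MULTI-REACH.** At the packet `(i+1, p)`: a UNIFORM UNIT-SLOT GAIN `r ≥ 0` over the fibre (`hgain`: at every place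
`x | p` some typed (Ind2)-mover `g ∈ Ism_x` carries some integer `y` (`‖y‖ ≤ 1`) to norm `≥ r`) and the GRADED CELL at every pilot place
(`hcell`: some mover carries `t_{Θ,i+1,x}·y`, `‖y‖ ≤ 1`, to a norm `R` with `‖t_{q,x}‖ ≤ R · r^{i+1}`) give abc-iut-w5-d107's multi-reach for
EVERY summand `e` (one place per slot): the pilot slot takes the cell's mover at `e(last)`, each of the `i+1` unit slots the gain mover at
its own place `e(a)`. [cite: DupuyHilado2025, §3.9, §4.9] [claim: Mochizuki2012, status: disputed] -/
theorem multiReach_of_gradedReach (i : Fin (thetaIndex X).lstar) {r : ℝ} (hr : 0 ≤ r)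
    (hgain : ∀ x : (thetaIndex X).Fibre (.inr pp), ∃ g ∈ (logShellsDH X logv).ism x.1, ∃ y : kOf X pp.1 x, ‖y‖ ≤ 1 ∧
      r ≤ ‖(presAt X hlog pp).φ x (g (((presAt X hlog pp).φ x).symm y))‖)
    (hcell : ∀ x : (thetaIndex X).Fibre (.inr pp), ∃ g ∈ (logShellsDH X logv).ism x.1, ∃ y : kOf X pp.1 x, ‖y‖ ≤ 1 ∧
      ‖tq pp x‖ ≤ ‖(presAt X hlog pp).φ x (g (((presAt X hlog pp).φ x).symm (t pp i x * y)))‖ * r ^ ((i : ℕ) + 1))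
    (e : (thetaIndex X).Caps (Setting.labelSucc i) → (thetaIndex X).Fibre (.inr pp)) :
    ∃ g : (thetaIndex X).Caps (Setting.labelSucc i) → ∀ x : (thetaIndex X).Fibre (.inr pp),
        (logShellsDH X logv).carrier x.1 ≃ₗ[ℚ] (logShellsDH X logv).carrier x.1,
      (∀ a x, g a x ∈ (logShellsDH X logv).ism x.1) ∧
      ∃ y : ∀ a, kOf X pp.1 (e a), (∀ a, ‖y a‖ ≤ 1) ∧
        ‖tq pp (e (Fin.last _))‖ ≤ ∏ a, ‖(presAt X hlog pp).φ (e a) (g a (e a) (((presAt X hlog pp).φ (e a)).symm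
          ((if a = Fin.last _ then t pp i (e a) else 1) * y a)))‖ := by
  classical
  choose gU hgU yU hyU hU using hgain
  choose gP hgP yP hyP hP using hcell
  refine ⟨fun a x => if a = Fin.last _ then gP x else gU x, fun a x => ?_,
    fun a => if a = Fin.last _ then yP (e a) else yU (e a), fun a => ?_, ?_⟩
  · dsimp only; split_ifs; exacts [hgP x, hgU x]
  · dsimp only; split_ifs; exacts [hyP (e a), hyU (e a)]
  · rw [← Finset.mul_prod_erase Finset.univ _ (Finset.mem_univ (Fin.last _))]
    have hlab : ((Setting.labelSucc i : (thetaIndex X).Label) : ℕ) = (i : ℕ) + 1 := by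
      simp [Setting.labelSucc]
    -- the `i+1` unit slots: each factor is at least `r`
    have hrest : r ^ ((i : ℕ) + 1) ≤ ∏ a ∈ Finset.univ.erase (Fin.last _),
        ‖(presAt X hlog pp).φ (e a) ((if a = Fin.last _ then gP (e a) else gU (e a))
          (((presAt X hlog pp).φ (e a)).symm ((if a = Fin.last _ then t pp i (e a) else 1) *
            (if a = Fin.last _ then yP (e a) else yU (e a)))))‖ := by
      have hcard : (Finset.univ.erase (Fin.last ((Setting.labelSucc i : (thetaIndex X).Label) : ℕ))).card = (i : ℕ) + 1 := by
        rw [Finset.card_erase_of_mem (Finset.mem_univ _), Finset.card_univ, Fintype.card_fin, hlab]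
        rfl
      calc r ^ ((i : ℕ) + 1) = ∏ _a ∈ Finset.univ.erase (Fin.last ((Setting.labelSucc i : (thetaIndex X).Label) : ℕ)), r := by
            rw [Finset.prod_const, hcard]
        _ ≤ _ := Finset.prod_le_prod (fun _ _ => hr) fun a ha => by
            have ha' : a ≠ Fin.last _ := Finset.ne_of_mem_erase ha
            rw [if_neg ha', if_neg ha', if_neg ha', one_mul]
            exact hU (e a)
    refine (hP (e (Fin.last _))).trans (mul_le_mul ?_ hrest (pow_nonneg hr _) (norm_nonneg _))
    dsimp only
    rw [if_pos rfl, if_pos rfl, if_pos rfl]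

/-- **GRADED CELL WITH THE PILOT SLOT UNMOVED** (`g = id`, `y = 1` on the pilot slot — the CARD's shape «`‖t_{q,x}‖ ≤ ‖t_{Θ,i+1,x}‖ · r^{i+1}`»,
i.e. `h(x, j) ≤ (Θ-depth) + j·(gain)`): ⟹ multi-reach. [cite: DupuyHilado2025, §3.9, §4.9] [claim: Mochizuki2012, status: disputed] -/
theorem multiReach_of_gradedCell (i : Fin (thetaIndex X).lstar) {r : ℝ} (hr : 0 ≤ r)
    (hgain : ∀ x : (thetaIndex X).Fibre (.inr pp), ∃ g ∈ (logShellsDH X logv).ism x.1, ∃ y : kOf X pp.1 x, ‖y‖ ≤ 1 ∧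
      r ≤ ‖(presAt X hlog pp).φ x (g (((presAt X hlog pp).φ x).symm y))‖)
    (hcell : ∀ x : (thetaIndex X).Fibre (.inr pp), ‖tq pp x‖ ≤ ‖t pp i x‖ * r ^ ((i : ℕ) + 1))
    (e : (thetaIndex X).Caps (Setting.labelSucc i) → (thetaIndex X).Fibre (.inr pp)) :
    ∃ g : (thetaIndex X).Caps (Setting.labelSucc i) → ∀ x : (thetaIndex X).Fibre (.inr pp),
        (logShellsDH X logv).carrier x.1 ≃ₗ[ℚ] (logShellsDH X logv).carrier x.1,
      (∀ a x, g a x ∈ (logShellsDH X logv).ism x.1) ∧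
      ∃ y : ∀ a, kOf X pp.1 (e a), (∀ a, ‖y a‖ ≤ 1) ∧
        ‖tq pp (e (Fin.last _))‖ ≤ ∏ a, ‖(presAt X hlog pp).φ (e a) (g a (e a) (((presAt X hlog pp).φ (e a)).symm
          ((if a = Fin.last _ then t pp i (e a) else 1) * y a)))‖ :=
  multiReach_of_gradedReach X hlog tq t pp i hr hgain (fun x => ⟨LinearEquiv.refl ℚ _, (logShellsDH X logv).one_mem_ism x.1, 1,
    norm_one.le, by rw [mul_one, LinearEquiv.refl_apply, LinearEquiv.apply_symm_apply]; exact hcell x⟩) e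

end Graded

/-! ## §2. The licence cell, the Licence and the Statement from a graded reach -/

section Licence

/-- **GRADED REACH ⟹ LICENCE CELL** at `(i+1, p)` of the sharp DH setting (abc-iut-w5-d107's `qRegion_subset_thetaHull_settingDHVolSharp_of_multiReach`
with §1). [cite: DupuyHilado2025, §3.9, §4.9] [claim: Mochizuki2012, status: disputed] -/
theorem qRegion_subset_thetaHull_settingDHVolSharp_of_gradedReach (pp : Nat.Primes) [Fact (pp : ℕ).Prime] (i : Fin (thetaIndex X).lstar)
    {r : ℝ} (hr : 0 ≤ r)
    (hgain : ∀ x : (thetaIndex X).Fibre (.inr pp), ∃ g ∈ (logShellsDH X logv).ism x.1, ∃ y : kOf X pp.1 x, ‖y‖ ≤ 1 ∧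
      r ≤ ‖(presAt X hlog pp).φ x (g (((presAt X hlog pp).φ x).symm y))‖)
    (hcell : ∀ x : (thetaIndex X).Fibre (.inr pp), ∃ g ∈ (logShellsDH X logv).ism x.1, ∃ y : kOf X pp.1 x, ‖y‖ ≤ 1 ∧
      ‖tq pp x‖ ≤ ‖(presAt X hlog pp).φ x (g (((presAt X hlog pp).φ x).symm (t pp i x * y)))‖ * r ^ ((i : ℕ) + 1)) :
    (settingDHVolSharp X hlog M archPk archSub Ψ act Mmod region n lat sig split qData tq t htq0 htq1).qRegion
        (Setting.labelSucc i) (.inr pp) ⊆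
      (settingDHVolSharp X hlog M archPk archSub Ψ act Mmod region n lat sig split qData tq t htq0 htq1).thetaHull
        (Setting.labelSucc i) (.inr pp) :=
  qRegion_subset_thetaHull_settingDHVolSharp_of_multiReach X hlog M archPk archSub Ψ act Mmod region n lat sig split qData tq t htq0
    htq1 pp i (multiReach_of_gradedReach X hlog tq t pp i hr hgain hcell)

/-- … the same cell at the PRINT-NORMALISED sharp setting `settingPrVolSharp` (same regions and frames). [claim: Mochizuki2012, status: disputed] -/
theorem qRegion_subset_thetaHull_settingPrVolSharp_of_gradedReach (pp : Nat.Primes) [Fact (pp : ℕ).Prime] (i : Fin (thetaIndex X).lstar)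
    {r : ℝ} (hr : 0 ≤ r)
    (hgain : ∀ x : (thetaIndex X).Fibre (.inr pp), ∃ g ∈ (logShellsDH X logv).ism x.1, ∃ y : kOf X pp.1 x, ‖y‖ ≤ 1 ∧
      r ≤ ‖(presAt X hlog pp).φ x (g (((presAt X hlog pp).φ x).symm y))‖)
    (hcell : ∀ x : (thetaIndex X).Fibre (.inr pp), ∃ g ∈ (logShellsDH X logv).ism x.1, ∃ y : kOf X pp.1 x, ‖y‖ ≤ 1 ∧
      ‖tq pp x‖ ≤ ‖(presAt X hlog pp).φ x (g (((presAt X hlog pp).φ x).symm (t pp i x * y)))‖ * r ^ ((i : ℕ) + 1)) :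
    (settingPrVolSharp X hlog M archPk archSub Ψ act Mmod region n lat sig split qData tq t htq0 htq1).qRegion
        (Setting.labelSucc i) (.inr pp) ⊆
      (settingPrVolSharp X hlog M archPk archSub Ψ act Mmod region n lat sig split qData tq t htq0 htq1).thetaHull
        (Setting.labelSucc i) (.inr pp) :=
  qRegion_subset_thetaHull_settingDHVolSharp_of_gradedReach X hlog M archPk archSub Ψ act Mmod region n lat sig split qData tq t htq0
    htq1 pp i hr hgain hcell

/-- **GRADED REACH AT EVERY PACKET ⟹ THE TYPED (xi-f) LICENCE** at `settingDHVolSharp` (one gain `r_{p,i} ≥ 0` per packet).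
[cite: DupuyHilado2025, §3.9, §4.9] [claim: Mochizuki2012, status: disputed] -/
theorem licence_settingDHVolSharp_of_gradedReach (r : Nat.Primes → Fin (thetaIndex X).lstar → ℝ) (hr : ∀ pp i, 0 ≤ r pp i)
    (hgain : ∀ (pp : Nat.Primes) (i : Fin (thetaIndex X).lstar), haveI : Fact (pp : ℕ).Prime := ⟨pp.2⟩
      ∀ x : (thetaIndex X).Fibre (.inr pp), ∃ g ∈ (logShellsDH X logv).ism x.1, ∃ y : kOf X pp.1 x, ‖y‖ ≤ 1 ∧
        r pp i ≤ ‖(presAt X hlog pp).φ x (g (((presAt X hlog pp).φ x).symm y))‖)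
    (hcell : ∀ (pp : Nat.Primes) (i : Fin (thetaIndex X).lstar), haveI : Fact (pp : ℕ).Prime := ⟨pp.2⟩
      ∀ x : (thetaIndex X).Fibre (.inr pp), ∃ g ∈ (logShellsDH X logv).ism x.1, ∃ y : kOf X pp.1 x, ‖y‖ ≤ 1 ∧
        ‖tq pp x‖ ≤ ‖(presAt X hlog pp).φ x (g (((presAt X hlog pp).φ x).symm (t pp i x * y)))‖ * r pp i ^ ((i : ℕ) + 1)) :
    Thm311ToCor312.Licence
        (settingDHVolSharp X hlog M archPk archSub Ψ act Mmod region n lat sig split qData tq t htq0 htq1) :=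
  licence_settingDHVolSharp_of_multiReach X hlog M archPk archSub Ψ act Mmod region n lat sig split qData tq t htq0 htq1
    fun pp i => by
      haveI : Fact (pp : ℕ).Prime := ⟨pp.2⟩
      exact multiReach_of_gradedReach X hlog tq t pp i (hr pp i) (hgain pp i) (hcell pp i)

/-- … and at `settingPrVolSharp`. [cite: DupuyHilado2025, §3.9, §4.9] [claim: Mochizuki2012, status: disputed] -/
theorem licence_settingPrVolSharp_of_gradedReach (r : Nat.Primes → Fin (thetaIndex X).lstar → ℝ) (hr : ∀ pp i, 0 ≤ r pp i)
    (hgain : ∀ (pp : Nat.Primes) (i : Fin (thetaIndex X).lstar), haveI : Fact (pp : ℕ).Prime := ⟨pp.2⟩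
      ∀ x : (thetaIndex X).Fibre (.inr pp), ∃ g ∈ (logShellsDH X logv).ism x.1, ∃ y : kOf X pp.1 x, ‖y‖ ≤ 1 ∧
        r pp i ≤ ‖(presAt X hlog pp).φ x (g (((presAt X hlog pp).φ x).symm y))‖)
    (hcell : ∀ (pp : Nat.Primes) (i : Fin (thetaIndex X).lstar), haveI : Fact (pp : ℕ).Prime := ⟨pp.2⟩
      ∀ x : (thetaIndex X).Fibre (.inr pp), ∃ g ∈ (logShellsDH X logv).ism x.1, ∃ y : kOf X pp.1 x, ‖y‖ ≤ 1 ∧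
        ‖tq pp x‖ ≤ ‖(presAt X hlog pp).φ x (g (((presAt X hlog pp).φ x).symm (t pp i x * y)))‖ * r pp i ^ ((i : ℕ) + 1)) :
    Thm311ToCor312.Licence
        (settingPrVolSharp X hlog M archPk archSub Ψ act Mmod region n lat sig split qData tq t htq0 htq1) :=
  fun i vQ => licence_settingDHVolSharp_of_gradedReach X hlog M archPk archSub Ψ act Mmod region n lat sig split qData tq t htq0 htq1
    r hr hgain hcell i vQ

/-- **… hence the typed Statement of [IUTchIII] Cor. 3.12 at the genuine print-normalised sharp setting** (Θ- and q-ideles non-zero and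
units off `S`: abc-iut-c312-7's `bridgeHyps_settingPrVolSharp_of_ideles`; abc-iut-c312-1's `statement_of_licence`). A CONDITIONAL positive: the
graded-reach numbers are the hypotheses. [cite: DupuyHilado2025, §3.4, §3.9, §4.9] [claim: Mochizuki2012, status: disputed] -/
theorem statement_settingPrVolSharp_of_gradedReach (ht0 : ∀ pp i x, t pp i x ≠ 0)
    (ht1 : ∀ (pp : Nat.Primes) (i : Fin X.lstar) (x : (thetaIndex X).Fibre (.inr pp)),
      haveI : Fact (pp : ℕ).Prime := ⟨pp.2⟩; placeOf X pp.1 x ∉ X.S → ‖t pp i x‖ = 1)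
    (r : Nat.Primes → Fin (thetaIndex X).lstar → ℝ) (hr : ∀ pp i, 0 ≤ r pp i)
    (hgain : ∀ (pp : Nat.Primes) (i : Fin (thetaIndex X).lstar), haveI : Fact (pp : ℕ).Prime := ⟨pp.2⟩
      ∀ x : (thetaIndex X).Fibre (.inr pp), ∃ g ∈ (logShellsDH X logv).ism x.1, ∃ y : kOf X pp.1 x, ‖y‖ ≤ 1 ∧
        r pp i ≤ ‖(presAt X hlog pp).φ x (g (((presAt X hlog pp).φ x).symm y))‖)
    (hcell : ∀ (pp : Nat.Primes) (i : Fin (thetaIndex X).lstar), haveI : Fact (pp : ℕ).Prime := ⟨pp.2⟩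
      ∀ x : (thetaIndex X).Fibre (.inr pp), ∃ g ∈ (logShellsDH X logv).ism x.1, ∃ y : kOf X pp.1 x, ‖y‖ ≤ 1 ∧
        ‖tq pp x‖ ≤ ‖(presAt X hlog pp).φ x (g (((presAt X hlog pp).φ x).symm (t pp i x * y)))‖ * r pp i ^ ((i : ℕ) + 1)) :
    (settingPrVolSharp X hlog M archPk archSub Ψ act Mmod region n lat sig split qData tq t htq0 htq1).Statement :=
  Thm311ToCor312.statement_of_licence
    (bridgeHyps_settingPrVolSharp_of_ideles X hlog M archPk archSub Ψ act Mmod region n lat sig split qData t tq ht0 ht1 htq0 htq1)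
    (licence_settingPrVolSharp_of_gradedReach X hlog M archPk archSub Ψ act Mmod region n lat sig split qData tq t htq0 htq1 r hr hgain
      hcell)

end Licence

/-! ## §3. The gains from the log-unit lattice: (Ind2) is transitive on each primitive level (abc-iut-w5-d180) -/

section Levels

variable (pp : Nat.Primes) [Fact (pp : ℕ).Prime]

/-- **TWO VECTORS AT THE SAME PRIMITIVE LEVEL OF `log_p(𝒪^×_x)` ARE RELATED BY A TYPED (Ind2)-MOVER**, in the presentation `φ_x` of the packet
factor `K_x` (abc-iut-w5-d180 `exists_mem_ismDH_apply_eq_of_primitive`, transported along the identities `φ_x = id`, `toR = ofR = id`): for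
`y, z ∈ c·log_p(𝒪^×_x)` both outside `p·c·log_p(𝒪^×_x)` there is `g ∈ Ism_x` with `φ_x(g(φ_x⁻¹ y)) = z`. Any place `x | p` (wild, several over
`p`, `p = 2`). [cite: WeilBNT1967, Ch. II §2, Th. 1] [cite: DupuyHilado2025, §4.9] -/
theorem exists_mem_ism_apply_eq_of_sameLevel (x : (thetaIndex X).Fibre (.inr pp)) (c : ℚ_[pp.1]) {y z : kOf X pp.1 x}
    (hy : y ∈ c • (logUnits (kOf X pp.1 x) : Set (kOf X pp.1 x)))
    (hyp : y ∉ ((pp.1 : ℚ_[pp.1]) * c) • (logUnits (kOf X pp.1 x) : Set (kOf X pp.1 x)))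
    (hz : z ∈ c • (logUnits (kOf X pp.1 x) : Set (kOf X pp.1 x)))
    (hzp : z ∉ ((pp.1 : ℚ_[pp.1]) * c) • (logUnits (kOf X pp.1 x) : Set (kOf X pp.1 x))) :
    ∃ g ∈ (logShellsDH X logv).ism x.1, (presAt X hlog pp).φ x (g (((presAt X hlog pp).φ x).symm y)) = z := by
  obtain ⟨x1, hx⟩ := x
  cases x1 with
  | inl u => exact absurd hx (by simp [thetaIndex])
  | inr v =>
    obtain ⟨g, hg, hgx⟩ := exists_mem_ismDH_apply_eq_of_primitive (hlog pp) (placeOf X pp.1 ⟨.inr v, hx⟩)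
      (natCast_mem_placeOf X pp.1 ⟨.inr v, hx⟩) hy hyp hz hzp
    exact ⟨g, hg, hgx⟩

/-- **UNIT-SLOT GAIN FROM THE LEVEL OF `1`.** If `1` and `z` lie at the same primitive level `c` of `log_p(𝒪^×_x)`, some typed (Ind2)-mover carries
the unit `1` (an integer, `‖1‖ ≤ 1`) to `z`: the unit slot at `x` GAINS `‖z‖`. [cite: WeilBNT1967, Ch. II §2, Th. 1] [cite: DupuyHilado2025, §4.9] -/
theorem unitGain_of_levelOne (x : (thetaIndex X).Fibre (.inr pp)) (c : ℚ_[pp.1]) {z : kOf X pp.1 x}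
    (h1 : (1 : kOf X pp.1 x) ∈ c • (logUnits (kOf X pp.1 x) : Set (kOf X pp.1 x)))
    (h1p : (1 : kOf X pp.1 x) ∉ ((pp.1 : ℚ_[pp.1]) * c) • (logUnits (kOf X pp.1 x) : Set (kOf X pp.1 x)))
    (hz : z ∈ c • (logUnits (kOf X pp.1 x) : Set (kOf X pp.1 x)))
    (hzp : z ∉ ((pp.1 : ℚ_[pp.1]) * c) • (logUnits (kOf X pp.1 x) : Set (kOf X pp.1 x))) :
    ∃ g ∈ (logShellsDH X logv).ism x.1, ∃ y : kOf X pp.1 x, ‖y‖ ≤ 1 ∧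
      ‖z‖ ≤ ‖(presAt X hlog pp).φ x (g (((presAt X hlog pp).φ x).symm y))‖ := by
  obtain ⟨g, hg, hgz⟩ := exists_mem_ism_apply_eq_of_sameLevel X hlog pp x c h1 h1p hz hzp
  exact ⟨g, hg, 1, norm_one.le, le_of_eq (by rw [hgz]; rfl)⟩

/-- **PILOT REACH FROM THE LEVEL OF THE Θ-IDELE.** If `t_{Θ,i+1,x}` and `z` lie at the same primitive level `c` of `log_p(𝒪^×_x)`, some typed
(Ind2)-mover carries `t_{Θ,i+1,x} · 1` to `z`: the pilot slot REACHES `‖z‖`. [cite: WeilBNT1967, Ch. II §2, Th. 1] [cite: DupuyHilado2025, §4.9] -/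
theorem pilotReach_of_level (x : (thetaIndex X).Fibre (.inr pp)) (i : Fin X.lstar) (c : ℚ_[pp.1]) {z : kOf X pp.1 x}
    (ht : t pp i x ∈ c • (logUnits (kOf X pp.1 x) : Set (kOf X pp.1 x)))
    (htp : t pp i x ∉ ((pp.1 : ℚ_[pp.1]) * c) • (logUnits (kOf X pp.1 x) : Set (kOf X pp.1 x)))
    (hz : z ∈ c • (logUnits (kOf X pp.1 x) : Set (kOf X pp.1 x)))
    (hzp : z ∉ ((pp.1 : ℚ_[pp.1]) * c) • (logUnits (kOf X pp.1 x) : Set (kOf X pp.1 x))) {R : ℝ} (hR : ‖tq pp x‖ ≤ ‖z‖ * R) :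
    ∃ g ∈ (logShellsDH X logv).ism x.1, ∃ y : kOf X pp.1 x, ‖y‖ ≤ 1 ∧
      ‖tq pp x‖ ≤ ‖(presAt X hlog pp).φ x (g (((presAt X hlog pp).φ x).symm (t pp i x * y)))‖ * R := by
  obtain ⟨g, hg, hgz⟩ := exists_mem_ism_apply_eq_of_sameLevel X hlog pp x c ht htp hz hzp
  exact ⟨g, hg, 1, norm_one.le, by rw [mul_one, hgz]; exact hR⟩

end Levels

/-! ## §4. The WILD CELL, assembled: levels of `1` (unit slots) and of `t_Θ` (pilot slot) ⟹ licence cell / Licence / Statement -/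

section Wild

/-- **THE WILD CELL.** At the packet `(i+1, p)` of the sharp DH setting, for ANY fibre over `p`: suppose `r ≥ 0` and, at every place `x | p`,
(a) an element `z₁(x)` at the primitive level `c₁(x)` of `1` in `log_p(𝒪^×_x)` with `r ≤ ‖z₁(x)‖` (uniform unit-slot gain), and (b) an element
`z_Θ(x)` at the primitive level `c_Θ(x)` of the Θ-idele `t_{Θ,i+1,x}` with the GRADED CELL `‖t_{q,x}‖ ≤ ‖z_Θ(x)‖ · r^{i+1}`. Then
`qRegion (i+1) p ⊆ thetaHull (i+1) p`. In exponents: `ord t_{q,x} ≥ ord z_Θ(x) + (i+1)·max_{x'} ord z₁(x')` suffices — the R-W wild-packet cell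
with the EXACT outer radii of the two levels (U-SHAPE), several places allowed. [cite: DupuyHilado2025, §3.9, §4.9] [cite: WeilBNT1967, Ch. II §2, Th. 1]
[claim: Mochizuki2012, status: disputed] -/
theorem qRegion_subset_thetaHull_settingDHVolSharp_of_latticeLevels (pp : Nat.Primes) [Fact (pp : ℕ).Prime] (i : Fin (thetaIndex X).lstar)
    {r : ℝ} (hr : 0 ≤ r)
    (c₁ cΘ : (thetaIndex X).Fibre (.inr pp) → ℚ_[pp.1]) (z₁ zΘ : ∀ x : (thetaIndex X).Fibre (.inr pp), kOf X pp.1 x)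
    (h1 : ∀ x, (1 : kOf X pp.1 x) ∈ c₁ x • (logUnits (kOf X pp.1 x) : Set (kOf X pp.1 x)) ∧
      (1 : kOf X pp.1 x) ∉ ((pp.1 : ℚ_[pp.1]) * c₁ x) • (logUnits (kOf X pp.1 x) : Set (kOf X pp.1 x)))
    (hz₁ : ∀ x, z₁ x ∈ c₁ x • (logUnits (kOf X pp.1 x) : Set (kOf X pp.1 x)) ∧
      z₁ x ∉ ((pp.1 : ℚ_[pp.1]) * c₁ x) • (logUnits (kOf X pp.1 x) : Set (kOf X pp.1 x)) ∧ r ≤ ‖z₁ x‖)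
    (hΘ : ∀ x, t pp i x ∈ cΘ x • (logUnits (kOf X pp.1 x) : Set (kOf X pp.1 x)) ∧
      t pp i x ∉ ((pp.1 : ℚ_[pp.1]) * cΘ x) • (logUnits (kOf X pp.1 x) : Set (kOf X pp.1 x)))
    (hzΘ : ∀ x, zΘ x ∈ cΘ x • (logUnits (kOf X pp.1 x) : Set (kOf X pp.1 x)) ∧
      zΘ x ∉ ((pp.1 : ℚ_[pp.1]) * cΘ x) • (logUnits (kOf X pp.1 x) : Set (kOf X pp.1 x)) ∧ ‖tq pp x‖ ≤ ‖zΘ x‖ * r ^ ((i : ℕ) + 1)) :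
    (settingDHVolSharp X hlog M archPk archSub Ψ act Mmod region n lat sig split qData tq t htq0 htq1).qRegion
        (Setting.labelSucc i) (.inr pp) ⊆
      (settingDHVolSharp X hlog M archPk archSub Ψ act Mmod region n lat sig split qData tq t htq0 htq1).thetaHull
        (Setting.labelSucc i) (.inr pp) :=
  qRegion_subset_thetaHull_settingDHVolSharp_of_gradedReach X hlog M archPk archSub Ψ act Mmod region n lat sig split qData tq t htq0 htq1
    pp i hr
    (fun x => by
      obtain ⟨g, hg, y, hy, hle⟩ := unitGain_of_levelOne X hlog pp x (c₁ x) (h1 x).1 (h1 x).2 (hz₁ x).1 (hz₁ x).2.1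
      exact ⟨g, hg, y, hy, (hz₁ x).2.2.trans hle⟩)
    fun x => pilotReach_of_level X hlog tq t pp x i (cΘ x) (hΘ x).1 (hΘ x).2 (hzΘ x).1 (hzΘ x).2.1 (hzΘ x).2.2

/-- **THE WILD CELLS AT EVERY PACKET ⟹ THE TYPED (xi-f) LICENCE at `settingPrVolSharp`** (levels and witnesses per packet `(i+1, p)` and place).
[cite: DupuyHilado2025, §3.9, §4.9] [claim: Mochizuki2012, status: disputed] -/
theorem licence_settingPrVolSharp_of_latticeLevels (r : Nat.Primes → Fin (thetaIndex X).lstar → ℝ) (hr : ∀ pp i, 0 ≤ r pp i)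
    (hlev : ∀ (pp : Nat.Primes) (i : Fin (thetaIndex X).lstar), haveI : Fact (pp : ℕ).Prime := ⟨pp.2⟩
      ∀ x : (thetaIndex X).Fibre (.inr pp), ∃ (c₁ cΘ : ℚ_[pp.1]) (z₁ zΘ : kOf X pp.1 x),
        ((1 : kOf X pp.1 x) ∈ c₁ • (logUnits (kOf X pp.1 x) : Set (kOf X pp.1 x)) ∧
          (1 : kOf X pp.1 x) ∉ ((pp.1 : ℚ_[pp.1]) * c₁) • (logUnits (kOf X pp.1 x) : Set (kOf X pp.1 x))) ∧
        (z₁ ∈ c₁ • (logUnits (kOf X pp.1 x) : Set (kOf X pp.1 x)) ∧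
          z₁ ∉ ((pp.1 : ℚ_[pp.1]) * c₁) • (logUnits (kOf X pp.1 x) : Set (kOf X pp.1 x)) ∧ r pp i ≤ ‖z₁‖) ∧
        (t pp i x ∈ cΘ • (logUnits (kOf X pp.1 x) : Set (kOf X pp.1 x)) ∧
          t pp i x ∉ ((pp.1 : ℚ_[pp.1]) * cΘ) • (logUnits (kOf X pp.1 x) : Set (kOf X pp.1 x))) ∧
        (zΘ ∈ cΘ • (logUnits (kOf X pp.1 x) : Set (kOf X pp.1 x)) ∧
          zΘ ∉ ((pp.1 : ℚ_[pp.1]) * cΘ) • (logUnits (kOf X pp.1 x) : Set (kOf X pp.1 x)) ∧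
          ‖tq pp x‖ ≤ ‖zΘ‖ * r pp i ^ ((i : ℕ) + 1))) :
    Thm311ToCor312.Licence
        (settingPrVolSharp X hlog M archPk archSub Ψ act Mmod region n lat sig split qData tq t htq0 htq1) := by
  refine licence_settingPrVolSharp_of_gradedReach X hlog M archPk archSub Ψ act Mmod region n lat sig split qData tq t htq0 htq1 r hr
    (fun pp i => ?_) (fun pp i => ?_)
  · haveI : Fact (pp : ℕ).Prime := ⟨pp.2⟩
    intro x
    obtain ⟨c₁, cΘ, z₁, zΘ, h1, hz₁, -, -⟩ := hlev pp i x
    obtain ⟨g, hg, y, hy, hle⟩ := unitGain_of_levelOne X hlog pp x c₁ h1.1 h1.2 hz₁.1 hz₁.2.1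
    exact ⟨g, hg, y, hy, hz₁.2.2.trans hle⟩
  · haveI : Fact (pp : ℕ).Prime := ⟨pp.2⟩
    intro x
    obtain ⟨c₁, cΘ, z₁, zΘ, -, -, hΘ, hzΘ⟩ := hlev pp i x
    exact pilotReach_of_level X hlog tq t pp x i cΘ hΘ.1 hΘ.2 hzΘ.1 hzΘ.2.1 hzΘ.2.2

/-- **… hence the typed Statement of [IUTchIII] Cor. 3.12 at the genuine sharp setting** (ideles non-zero and units off `S`). CONDITIONAL
positive; the level data are the hypotheses. [cite: DupuyHilado2025, §3.4, §3.9, §4.9] [claim: Mochizuki2012, status: disputed] -/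
theorem statement_settingPrVolSharp_of_latticeLevels (ht0 : ∀ pp i x, t pp i x ≠ 0)
    (ht1 : ∀ (pp : Nat.Primes) (i : Fin X.lstar) (x : (thetaIndex X).Fibre (.inr pp)),
      haveI : Fact (pp : ℕ).Prime := ⟨pp.2⟩; placeOf X pp.1 x ∉ X.S → ‖t pp i x‖ = 1)
    (r : Nat.Primes → Fin (thetaIndex X).lstar → ℝ) (hr : ∀ pp i, 0 ≤ r pp i)
    (hlev : ∀ (pp : Nat.Primes) (i : Fin (thetaIndex X).lstar), haveI : Fact (pp : ℕ).Prime := ⟨pp.2⟩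
      ∀ x : (thetaIndex X).Fibre (.inr pp), ∃ (c₁ cΘ : ℚ_[pp.1]) (z₁ zΘ : kOf X pp.1 x),
        ((1 : kOf X pp.1 x) ∈ c₁ • (logUnits (kOf X pp.1 x) : Set (kOf X pp.1 x)) ∧
          (1 : kOf X pp.1 x) ∉ ((pp.1 : ℚ_[pp.1]) * c₁) • (logUnits (kOf X pp.1 x) : Set (kOf X pp.1 x))) ∧
        (z₁ ∈ c₁ • (logUnits (kOf X pp.1 x) : Set (kOf X pp.1 x)) ∧
          z₁ ∉ ((pp.1 : ℚ_[pp.1]) * c₁) • (logUnits (kOf X pp.1 x) : Set (kOf X pp.1 x)) ∧ r pp i ≤ ‖z₁‖) ∧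
        (t pp i x ∈ cΘ • (logUnits (kOf X pp.1 x) : Set (kOf X pp.1 x)) ∧
          t pp i x ∉ ((pp.1 : ℚ_[pp.1]) * cΘ) • (logUnits (kOf X pp.1 x) : Set (kOf X pp.1 x))) ∧
        (zΘ ∈ cΘ • (logUnits (kOf X pp.1 x) : Set (kOf X pp.1 x)) ∧
          zΘ ∉ ((pp.1 : ℚ_[pp.1]) * cΘ) • (logUnits (kOf X pp.1 x) : Set (kOf X pp.1 x)) ∧
          ‖tq pp x‖ ≤ ‖zΘ‖ * r pp i ^ ((i : ℕ) + 1))) :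
    (settingPrVolSharp X hlog M archPk archSub Ψ act Mmod region n lat sig split qData tq t htq0 htq1).Statement :=
  Thm311ToCor312.statement_of_licence
    (bridgeHyps_settingPrVolSharp_of_ideles X hlog M archPk archSub Ψ act Mmod region n lat sig split qData t tq ht0 ht1 htq0 htq1)
    (licence_settingPrVolSharp_of_latticeLevels X hlog M archPk archSub Ψ act Mmod region n lat sig split qData tq t htq0 htq1 r hr hlev)

end Wild

end Summit.ABC.IUTFork.Thm311.Real

end
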